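import Summits.HodgeConjecture.HodgeConjecture.Theorems.K2E5QuatThetaPoisson            -- ★ R3 (p856069): theta inversion; brings ★ G11a∕b∕c, ★ #3g, ★ `quatCoordInv`
import Summits.HodgeConjecture.HodgeConjecture.Theorems.K2E5QuatZetaResidueOfParts       -- ★ R0 (p856054, K2E5-p07): `quatZetaResidue_of_parts` (the `hminus` bytes this file serves)
import Summits.HodgeConjecture.HodgeConjecture.Theorems.K2E5DetSUUnimodularWitness       -- ★ B8 (p855022): `isInvInvariant_of_isMulRightInvariant`
import Summits.HodgeConjecture.HodgeConjecture.Theorems.K2E5QuatDivisionIffAnisotropic     -- ★ C4: `isUnit_of_mem_of_anisotropic` (D_h is a division algebra for anisotropic h)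
import HarnessLib

/-!
# K2 ∕ E5 «TamagawaUnitary», unit G «ZETA» — R4 `K2E5QuatZetaMinusPrincipalPart`: the contracting half of the zeta integral of `D_h` (organs, ED. 1)

Cell `hodgecm-mathlib` (Track B «K2-LIT»), item h413 = `stmt-HodgeConjecture-24833`; dealt BY NAME by the G3 lead K2E5-p07 (g0) (2026-09-04T00:19:37Z, booked by
K2E5-plan (g2)), to base K2E5-p14; author K2E5-p14 (g0).  PROOF lane (theorems only, `--supports stmt-HodgeConjecture-24833 --as helper`).  Rung R4 of the G3 residue
ladder: the hypothesis `hminus` of ★ R0 `K2E5QuatZetaResidueOfParts.quatZetaResidue_of_parts` — for `t ≤ 0`,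
`‖e^t · (I_Φ(t) + V·Φ(0)) − V·Φ̂(0)∕ν⁴(F)‖ ≤ B e^{κ t}`, `I_Φ(t) = ∫_{U¹} Φ(y θ_{e^t}) dx¹(y)`, `V = covol(U¹ ∕ Γ_h)`.

ROAD (Tate–Weil refolding; (a)–(e) of the bus line 2026-09-04T00:3xZ): unfold `I_Φ(t)` over `Γ_h`, rewrite the `Γ_h`-sum as the `D_h`-sum minus the zero term
(division algebra), apply the theta inversion ★ R3 at `x = y θ_t`, refold the dual `D_h`-sum into `I_{Φ̂}(−t)` using `γ ↦ γ⁻¹` and the inversion invariance of `dx¹`,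
and bound `I_{Φ̂}(−t)` by ★ R2 (`hplus` for the Schwartz–Bruhat function `Φ̂`).  THIS EDITION lands the organs that do not depend on R2's bytes:
* §0 **`quatFourierCoord_quatCoordInv_zero`**: `Φ̂(0) = ∫ Φ ∘ quatCoord e dν4` — NO Gram ∕ self-duality constant (the socket's limit bytes are right as printed).
* §1 **`fourier_mem_quatSchwartzBruhat`**: `Φ̂ := (m ↦ quatFourierCoord L ν4 G e Φ (quatCoordInv m)) ∈ 𝒮(D_{h,𝔸})` (★ `adelicPiFourier_mem_piSchwartzBruhat` + ★
  `comp_mulVec_mem_piSchwartzBruhat` for the invertible rational Gram matrix `G ⊗ 1`).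
* §2 **`integral_comp_inv_eq`**: `∫ f(u⁻¹) dx¹ = ∫ f(u) dx¹` on `U¹ = quatAdelicUnitsOne` for a Haar measure that is also right invariant (★ B8), and the module bookkeeping
  of the central ray `θ`: `θ_s⁻¹ = θ_{s⁻¹}`, `(y θ)⁻¹ = θ⁻¹ y⁻¹ = y⁻¹ θ⁻¹`.

HONEST LABEL: HC_CM is proved only modulo the 7 printed citations (2 remaining named inputs: hLiu418 = stmt-HodgeConjecture-24832,
h413 = stmt-HodgeConjecture-24833) until rung 0 closes; this file is part of rung R4 of ONE tier-1 socket's proof ladder and discharges no socket by itself.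

AUDIT (materialised pages; `book:vignerasnd-arithmetique-des-algebres-de-quaternions` = V80): V80 p0062.txt–p0063.txt (Ch. III §2, proof of Thm. 2.2: the `‖y‖ < 1` half
`∫_{Y} … = ∫ (‖y‖⁻¹ ∑ Φ*(x y⁻¹) − Φ(0)) …`, refolded with `y ↦ y⁻¹`).

## References
* [VignerasLNM800] M.-F. Vignéras, *Arithmétique des algèbres de quaternions*, LNM 800 (1980) — Ch. III §2 Thm. 2.2 (proof).
* [WeilBNT1967] A. Weil, *Basic Number Theory* (1967) — Ch. VII §5 Prop. 11, §6 (proof of Thm. 4).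
* [TateThesis1967] J. Tate, in Cassels–Fröhlich (1967), Ch. XV §4.4 (Main Theorem 4.4.1, the `|x| < 1` half).
-/

set_option autoImplicit false
set_option linter.dupNamespace false

noncomputable section

namespace Summit.HodgeConjecture.HodgeConjecture.Cruxes.H413.K2E5QuatZetaMinusPrincipalPart

open MeasureTheory Measure NumberField IsDedekindDomain Filter Topology
open Literature.NumberTheory Literature.NumberTheory.Automorphic
open Literature.AlgebraicGeometry.ShimuraVarieties
open Summit.HodgeConjecture.HodgeConjecture.Cruxes.H413.K2E5QuatAdelicMatrixModel
open Summit.HodgeConjecture.HodgeConjecture.Cruxes.H413.K2E5QuatAdelicRat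
open Summit.HodgeConjecture.HodgeConjecture.Cruxes.H413.K2E5QuatZeta
open Summit.HodgeConjecture.HodgeConjecture.Cruxes.H413.K2E5QuatAdelicCoordinates
open Summit.HodgeConjecture.HodgeConjecture.Cruxes.H413.K2E5QuatAdelicLattice
open Summit.HodgeConjecture.HodgeConjecture.Cruxes.H413.K2E5QuatAdelicModuleOne
open Summit.HodgeConjecture.HodgeConjecture.Cruxes.H413.K2E5QuatGramNondegenerate
open Summit.HodgeConjecture.HodgeConjecture.Cruxes.H413.K2E5QuatSchwartzBruhatDilate
open scoped Matrix MatrixGroups NNReal ENNReal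

variable (L : Type) [Field L] [NumberField L] [IsCMField L] {Ha : Matrix (Fin 2) (Fin 2) L}

/-! ## §0 `Φ̂(0) = ∫ Φ ∘ quatCoord e dν4` — no constant -/

/-- `quatCoordInv 0 = 0` (`quatCoordInv ∘ quatCoord e = id`, ★ `quatCoordInv_quatCoord`, and `quatCoord e 0 = 0`). [folklore] -/
theorem quatCoordInv_zero (hHa : (Ha.map (cmConjRingHom L)).transpose = Ha) (hdet : Ha.det ≠ 0) :
    quatCoordInv L hHa hdet 0 = 0 := by
  rw [← map_zero (quatCoord L (fun i => ((quatBasis L Ha hHa hdet i : ↥(quatRatSubalgebra L Ha)) : Matrix (Fin 2) (Fin 2) L))),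
    quatCoordInv_quatCoord]

section Fourier

variable [MeasurableSpace (AdeleRing (𝓞 ↥(maximalRealSubfield L)) ↥(maximalRealSubfield L))]
  [BorelSpace (AdeleRing (𝓞 ↥(maximalRealSubfield L)) ↥(maximalRealSubfield L))]
  (ν4 : Measure (Fin 4 → AdeleRing (𝓞 ↥(maximalRealSubfield L)) ↥(maximalRealSubfield L))) [ν4.IsAddHaarMeasure]

omit [BorelSpace (AdeleRing (𝓞 ↥(maximalRealSubfield L)) ↥(maximalRealSubfield L))] [ν4.IsAddHaarMeasure] in
/-- **`Φ̂(0) = ∫ Φ ∘ quatCoord e dν4`** for the trd-Fourier transform in coordinates (★ #3g `quatFourierCoord`) evaluated at `quatCoordInv 0 = 0`: the character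
factor is `ψ_{L⁺}(0) = 1`, so NO Gram-determinant ∕ self-duality constant appears — the constant in the limit of socket G3 is exactly Poisson's `ν4(F)⁻¹`.
[cite: VignerasLNM800, Ch. III §2 Thm. 2.2 (résidu vol(X_{A,1}∕X_K^•)·Φ̂(0))] [cite: TateThesis1967, §4.4] -/
theorem quatFourierCoord_quatCoordInv_zero (hHa : (Ha.map (cmConjRingHom L)).transpose = Ha) (hdet : Ha.det ≠ 0)
    (Φ : Matrix (Fin 2) (Fin 2) (AdeleRing (𝓞 L) L) → ℂ) :
    quatFourierCoord L ν4 (quatGramReal L hdet (coe_quatBasis_mem L Ha hHa hdet))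
        (fun i => ((quatBasis L Ha hHa hdet i : ↥(quatRatSubalgebra L Ha)) : Matrix (Fin 2) (Fin 2) L)) Φ (quatCoordInv L hHa hdet 0) =
      ∫ a, Φ (quatCoord L (fun i => ((quatBasis L Ha hHa hdet i : ↥(quatRatSubalgebra L Ha)) : Matrix (Fin 2) (Fin 2) L)) a) ∂ν4 := by
  rw [quatCoordInv_zero, quatFourierCoord_apply]
  refine integral_congr_ae (Eventually.of_forall fun a => ?_)
  rw [Matrix.mulVec_zero]
  simp only [Pi.zero_apply, zero_mul, Finset.sum_const_zero, AddChar.map_zero_eq_one, Circle.coe_one, mul_one]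

/-! ## §1 `Φ̂ ∈ 𝒮(D_{h,𝔸})` -/

/-- **The trd-Fourier transform of a Schwartz–Bruhat function is Schwartz–Bruhat**: for `Φ ∈ 𝒮(D_{h,𝔸})`, the function
`Φ̂ := m ↦ quatFourierCoord L ν4 G e Φ (quatCoordInv m)` on `M₂(𝔸_L)` lies in `𝒮(D_{h,𝔸})` — its pull-back by `quatCoord e` is
`b ↦ (Φ ∘ quatCoord e)^((G ⊗ 1) b)` (★ `quatCoordInv_quatCoord`), the adelic Fourier transform (★ `adelicPiFourier_mem_piSchwartzBruhat`) precomposed with the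
invertible matrix `G ⊗ 1` (★ `det_quatGramReal_ne_zero`, ★ `comp_mulVec_mem_piSchwartzBruhat`). [cite: WeilBNT1967, Ch. VII §2 Thm. 1 & Prop. 2] [cite: VignerasLNM800, Ch. II §4] -/
theorem fourier_mem_quatSchwartzBruhat (hHa : (Ha.map (cmConjRingHom L)).transpose = Ha) (hdet : Ha.det ≠ 0)
    {Φ : Matrix (Fin 2) (Fin 2) (AdeleRing (𝓞 L) L) → ℂ}
    (hΦ : Φ ∈ quatSchwartzBruhat L (fun i => ((quatBasis L Ha hHa hdet i : ↥(quatRatSubalgebra L Ha)) : Matrix (Fin 2) (Fin 2) L))) :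
    (fun m => quatFourierCoord L ν4 (quatGramReal L hdet (coe_quatBasis_mem L Ha hHa hdet))
        (fun i => ((quatBasis L Ha hHa hdet i : ↥(quatRatSubalgebra L Ha)) : Matrix (Fin 2) (Fin 2) L)) Φ (quatCoordInv L hHa hdet m)) ∈
      quatSchwartzBruhat L (fun i => ((quatBasis L Ha hHa hdet i : ↥(quatRatSubalgebra L Ha)) : Matrix (Fin 2) (Fin 2) L)) := by
  rw [mem_quatSchwartzBruhat_iff] at hΦ ⊢
  set G := quatGramReal L hdet (coe_quatBasis_mem L Ha hHa hdet) with hG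
  set M : Matrix (Fin 4) (Fin 4) (AdeleRing (𝓞 ↥(maximalRealSubfield L)) ↥(maximalRealSubfield L)) :=
    G.map (algebraMap (↥(maximalRealSubfield L)) (AdeleRing (𝓞 ↥(maximalRealSubfield L)) ↥(maximalRealSubfield L))) with hM
  have hGdet : IsUnit G.det := isUnit_iff_ne_zero.2 (det_quatGramReal_ne_zero L hHa hdet)
  have hMM : M * (G⁻¹).map (algebraMap (↥(maximalRealSubfield L)) (AdeleRing (𝓞 ↥(maximalRealSubfield L)) ↥(maximalRealSubfield L))) = 1 := by
    rw [hM, ← Matrix.map_mul, Matrix.mul_nonsing_inv G hGdet, Matrix.map_one _ (map_zero _) (map_one _)]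
  have hMM' : (G⁻¹).map (algebraMap (↥(maximalRealSubfield L)) (AdeleRing (𝓞 ↥(maximalRealSubfield L)) ↥(maximalRealSubfield L))) * M = 1 := by
    rw [hM, ← Matrix.map_mul, Matrix.nonsing_inv_mul G hGdet, Matrix.map_one _ (map_zero _) (map_one _)]
  have h := comp_mulVec_mem_piSchwartzBruhat (↥(maximalRealSubfield L)) (adelicPiFourier_mem_piSchwartzBruhat (ν := ν4) hΦ) M _ hMM hMM'
  have hfun : (fun b => quatFourierCoord L ν4 G (fun i => ((quatBasis L Ha hHa hdet i : ↥(quatRatSubalgebra L Ha)) : Matrix (Fin 2) (Fin 2) L)) Φ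
      (quatCoordInv L hHa hdet (quatCoord L (fun i => ((quatBasis L Ha hHa hdet i : ↥(quatRatSubalgebra L Ha)) : Matrix (Fin 2) (Fin 2) L)) b))) =
      fun b => adelicPiFourier (↥(maximalRealSubfield L)) (Fin 4) ν4
        (fun a => Φ (quatCoord L (fun i => ((quatBasis L Ha hHa hdet i : ↥(quatRatSubalgebra L Ha)) : Matrix (Fin 2) (Fin 2) L)) a)) (M *ᵥ b) := by
    funext b
    rw [quatCoordInv_quatCoord]
    rfl
  rw [hfun]
  exact h

end Fourier

/-! ## §2 Inversion invariance of `dx¹` on `U¹` and the central ray -/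

section Inversion

variable [MeasurableSpace (GL (Fin 2) (AdeleRing (𝓞 L) L))] [BorelSpace (GL (Fin 2) (AdeleRing (𝓞 L) L))]
  [LocallyCompactSpace ↥(quatAdelicUnitsOne L Ha)] [SecondCountableTopology ↥(quatAdelicUnitsOne L Ha)]

/-- **`∫ f(u⁻¹) dx¹(u) = ∫ f(u) dx¹(u)`** on `U¹ = D^{(1)}_{h,𝔸}` for a Haar measure `dx¹` that is also right invariant (the hypotheses of socket G3): a bi-invariant
Haar measure on a second-countable locally compact group is inversion invariant (★ B8 `isInvInvariant_of_isMulRightInvariant`; Mathlib `integral_inv_eq_self`).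
[cite: WeilBNT1967, Ch. VII §6 (proof of Thm. 4: y ↦ y⁻¹)] [cite: VignerasLNM800, Ch. III §2] -/
theorem integral_comp_inv_eq {E : Type*} [NormedAddCommGroup E] [NormedSpace ℝ E]
    (dx1 : Measure ↥(quatAdelicUnitsOne L Ha)) [dx1.IsHaarMeasure] [dx1.IsMulRightInvariant]
    (f : ↥(quatAdelicUnitsOne L Ha) → E) :
    ∫ u, f u⁻¹ ∂dx1 = ∫ u, f u ∂dx1 := by
  obtain ⟨K₀⟩ := (inferInstance : Nonempty (TopologicalSpace.PositiveCompacts ↥(quatAdelicUnitsOne L Ha)))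
  haveI : dx1.Regular := regular_of_isMulLeftInvariant K₀.isCompact K₀.interior_nonempty K₀.isCompact.measure_lt_top.ne
  haveI := K2E5DetSUUnimodularWitness.isInvInvariant_of_isMulRightInvariant dx1
  exact integral_inv_eq_self f dx1

omit [MeasurableSpace (GL (Fin 2) (AdeleRing (𝓞 L) L))] [BorelSpace (GL (Fin 2) (AdeleRing (𝓞 L) L))]
  [LocallyCompactSpace ↥(quatAdelicUnitsOne L Ha)] [SecondCountableTopology ↥(quatAdelicUnitsOne L Ha)] in
/-- **`θ` commutes past everything and inverts along the ray**: for `y ∈ (D_h ⊗ 𝔸)^×` and `s ∈ ℝ_{>0}^×`, `(y · θ_s)⁻¹ = y⁻¹ · θ_{s⁻¹}` (★ `quatModuleSection_mul_comm`,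
`map_inv`). [cite: WeilBNT1967, Ch. IV §4] -/
theorem mul_quatModuleSection_inv (y : ↥(quatAdelicUnits L Ha)) (s : ℝ≥0ˣ) :
    (y * quatModuleSection L Ha s)⁻¹ = y⁻¹ * quatModuleSection L Ha s⁻¹ := by
  rw [mul_inv_rev, ← map_inv, quatModuleSection_mul_comm]

omit [MeasurableSpace (GL (Fin 2) (AdeleRing (𝓞 L) L))] [BorelSpace (GL (Fin 2) (AdeleRing (𝓞 L) L))]
  [LocallyCompactSpace ↥(quatAdelicUnitsOne L Ha)] [SecondCountableTopology ↥(quatAdelicUnitsOne L Ha)] in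
/-- The ray parameter at `−t` is the inverse of the ray parameter at `t`: `mk0 (e^{−t}) = (mk0 (e^t))⁻¹` in `ℝ_{>0}^×`. [folklore] -/
theorem mk0_exp_neg (t : ℝ) :
    Units.mk0 (Real.toNNReal (Real.exp (-t))) (Real.toNNReal_pos.2 (Real.exp_pos (-t))).ne' =
      (Units.mk0 (Real.toNNReal (Real.exp t)) (Real.toNNReal_pos.2 (Real.exp_pos t)).ne')⁻¹ := by
  ext
  rw [Units.val_inv_eq_inv_val, Units.val_mk0, Units.val_mk0, Real.exp_neg, Real.toNNReal_inv]

end Inversion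

/-! ## §3 (ED. 2) `Γ_h`-sums are `D_h`-sums without the zero term (division algebra) -/

section GammaSums

/-- **From a nonzero rational quaternion to an element of `Γ_h ≤ U¹`** (anisotropic `h`): `ξ ∈ D_h`, `ξ ≠ 0` is invertible in `M₂(L)` (★ C4
`isUnit_of_mem_of_anisotropic`), its unit lies in `D_h(L⁺)^×` (★ `mem_quatRatUnits_iff`), `ξ ⊗ 1 ∈ Γ_h` (★ `mem_quatAdelicRatUnits_iff`) and `Γ_h ≤ U¹`
(★ `quatRatLattice_le_quatAdelicUnitsOne`, product formula). [cite: VignerasLNM800, Ch. III §1 (X_K^• ⊂ X_{A,1})] [cite: WeilBNT1967, Ch. IV §4 Thm. 5] -/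
theorem exists_quatRatLatticeOne_coe_eq (hanis : ∀ v : Fin 2 → L, hermForm (cmConjRingHom L) Ha v v = 0 → v = 0)
    (ξ : ↥(quatRatSubalgebra L Ha)) (hξ : ξ ≠ 0) :
    ∃ γ : ↥(quatRatLatticeOne L Ha),
      ((((γ : ↥(quatAdelicUnitsOne L Ha)) : ↥(quatAdelicUnits L Ha)) : GL (Fin 2) (AdeleRing (𝓞 L) L)) : Matrix (Fin 2) (Fin 2) (AdeleRing (𝓞 L) L)) =
        (ξ : Matrix (Fin 2) (Fin 2) L).map (algebraMap L (AdeleRing (𝓞 L) L)) := by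
  have hξ0 : (ξ : Matrix (Fin 2) (Fin 2) L) ≠ 0 := fun h => hξ (Subtype.ext h)
  have hunit : IsUnit (ξ : Matrix (Fin 2) (Fin 2) L) :=
    K2E5QuatDivisionIffAnisotropic.isUnit_of_mem_of_anisotropic Ha hanis _ ((mem_quatRatSubalgebra_iff L Ha _).1 ξ.2) hξ0
  set u : GL (Fin 2) L := hunit.unit with hu
  have huval : ((u : GL (Fin 2) L) : Matrix (Fin 2) (Fin 2) L) = (ξ : Matrix (Fin 2) (Fin 2) L) := hunit.unit_spec
  have huD : u ∈ quatRatUnits L Ha := by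
    rw [mem_quatRatUnits_iff, huval]
    exact (mem_quatRatSubalgebra_iff L Ha _).1 ξ.2
  have hxR : toAdeleGL L u ∈ quatAdelicRatUnits L Ha := (mem_quatAdelicRatUnits_iff L Ha _).2 ⟨u, huD, rfl⟩
  have hxU : toAdeleGL L u ∈ quatAdelicUnits L Ha := quatAdelicRatUnits_le_quatAdelicUnits L Ha hxR
  have hxΓ : (⟨toAdeleGL L u, hxU⟩ : ↥(quatAdelicUnits L Ha)) ∈ quatRatLattice L Ha := (mem_quatRatLattice_iff L Ha _).2 hxR
  have hx1 : (⟨toAdeleGL L u, hxU⟩ : ↥(quatAdelicUnits L Ha)) ∈ quatAdelicUnitsOne L Ha := quatRatLattice_le_quatAdelicUnitsOne L Ha hxΓ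
  refine ⟨⟨⟨⟨toAdeleGL L u, hxU⟩, hx1⟩, (mem_quatRatLatticeOne_iff L Ha _).2 hxΓ⟩, ?_⟩
  change ((toAdeleGL L u : GL (Fin 2) (AdeleRing (𝓞 L) L)) : Matrix (Fin 2) (Fin 2) (AdeleRing (𝓞 L) L)) = _
  rw [val_toAdeleGL, huval]

/-- **From an element of `Γ_h` to a nonzero rational quaternion**: `γ ∈ Γ_h` is `γ₀ ⊗ 1` for a unit `γ₀ ∈ D_h(L⁺)^×` (★ `mem_quatRatLattice_iff_exists`), whose matrix is a
NONZERO element of `D_h`. [cite: VignerasLNM800, Ch. III §1] -/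
theorem exists_coe_eq_map_of_mem_quatRatLatticeOne (γ : ↥(quatRatLatticeOne L Ha)) :
    ∃ ξ : ↥(quatRatSubalgebra L Ha), ξ ≠ 0 ∧
      ((((γ : ↥(quatAdelicUnitsOne L Ha)) : ↥(quatAdelicUnits L Ha)) : GL (Fin 2) (AdeleRing (𝓞 L) L)) : Matrix (Fin 2) (Fin 2) (AdeleRing (𝓞 L) L)) =
        (ξ : Matrix (Fin 2) (Fin 2) L).map (algebraMap L (AdeleRing (𝓞 L) L)) := by
  have hγ : (((γ : ↥(quatAdelicUnitsOne L Ha)) : ↥(quatAdelicUnits L Ha))) ∈ quatRatLattice L Ha := (mem_quatRatLatticeOne_iff L Ha _).1 γ.2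
  obtain ⟨γ₀, hγ₀D, hγ₀⟩ := (mem_quatRatLattice_iff_exists L Ha _).1 hγ
  refine ⟨⟨((γ₀ : GL (Fin 2) L) : Matrix (Fin 2) (Fin 2) L), (mem_quatRatSubalgebra_iff L Ha _).2 ((mem_quatRatUnits_iff L Ha γ₀).1 hγ₀D)⟩, ?_, ?_⟩
  · intro h0
    have h0' : ((γ₀ : GL (Fin 2) L) : Matrix (Fin 2) (Fin 2) L) = 0 := congrArg Subtype.val h0
    have h1 : ((γ₀ : GL (Fin 2) L) : Matrix (Fin 2) (Fin 2) L) * ((γ₀⁻¹ : GL (Fin 2) L) : Matrix (Fin 2) (Fin 2) L) = 1 := by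
      rw [← Units.val_mul, mul_inv_cancel, Units.val_one]
    rw [h0', Matrix.zero_mul] at h1
    exact zero_ne_one h1
  · rw [← hγ₀, val_toAdeleGL]

/-- **`Γ_h`-SUMS ARE `D_h`-SUMS WITHOUT THE ZERO TERM** (anisotropic `h`, so `D_h` is a division algebra and `Γ_h = D_h^× = D_h ∖ {0}`): for every `f` on `M₂(𝔸_L)` whose
values along `D_h ⊗ 1` are summable, `∑_{γ ∈ Γ_h} f(γ) = ∑_{ξ ∈ D_h} f(ξ ⊗ 1) − f(0)` (reindexing along the bijection `ξ ↦ ξ ⊗ 1`, Mathlib `Equiv.tsum_eq`,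
`Summable.sum_add_tsum_subtype_compl`). [cite: VignerasLNM800, Ch. III §2 (proof of Thm. 2.2: ∑_{X_K^•} = ∑_{X_K} − Φ(0))] [cite: WeilBNT1967, Ch. VII §6] -/
theorem tsum_quatRatLatticeOne_eq (hanis : ∀ v : Fin 2 → L, hermForm (cmConjRingHom L) Ha v v = 0 → v = 0)
    (f : Matrix (Fin 2) (Fin 2) (AdeleRing (𝓞 L) L) → ℂ)
    (hf : Summable fun ξ : ↥(quatRatSubalgebra L Ha) => f ((ξ : Matrix (Fin 2) (Fin 2) L).map (algebraMap L (AdeleRing (𝓞 L) L)))) :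
    ∑' γ : ↥(quatRatLatticeOne L Ha),
        f ((((γ : ↥(quatAdelicUnitsOne L Ha)) : ↥(quatAdelicUnits L Ha)) : GL (Fin 2) (AdeleRing (𝓞 L) L)) : Matrix (Fin 2) (Fin 2) (AdeleRing (𝓞 L) L)) =
      ∑' ξ : ↥(quatRatSubalgebra L Ha), f ((ξ : Matrix (Fin 2) (Fin 2) L).map (algebraMap L (AdeleRing (𝓞 L) L))) - f 0 := by
  classical
  -- the map `Γ_h → {ξ ∈ D_h : ξ ≠ 0}` and its bijectivity
  let ρ : ↥(quatRatLatticeOne L Ha) → {ξ : ↥(quatRatSubalgebra L Ha) // ξ ∉ ({0} : Finset ↥(quatRatSubalgebra L Ha))} := fun γ =>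
    ⟨Classical.choose (exists_coe_eq_map_of_mem_quatRatLatticeOne L γ), by
      rw [Finset.mem_singleton]; exact (Classical.choose_spec (exists_coe_eq_map_of_mem_quatRatLatticeOne L γ)).1⟩
  have hρ : ∀ γ : ↥(quatRatLatticeOne L Ha),
      ((((γ : ↥(quatAdelicUnitsOne L Ha)) : ↥(quatAdelicUnits L Ha)) : GL (Fin 2) (AdeleRing (𝓞 L) L)) : Matrix (Fin 2) (Fin 2) (AdeleRing (𝓞 L) L)) =
        (((ρ γ : ↥(quatRatSubalgebra L Ha)) : Matrix (Fin 2) (Fin 2) L)).map (algebraMap L (AdeleRing (𝓞 L) L)) := fun γ =>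
    (Classical.choose_spec (exists_coe_eq_map_of_mem_quatRatLatticeOne L γ)).2
  have hinj_map : Function.Injective (fun m : Matrix (Fin 2) (Fin 2) L => m.map (algebraMap L (AdeleRing (𝓞 L) L))) := by
    haveI : Nontrivial (AdeleRing (𝓞 L) L) := inferInstanceAs (Nontrivial (InfiniteAdeleRing L × FiniteAdeleRing (𝓞 L) L))
    exact Matrix.map_injective (algebraMap L (AdeleRing (𝓞 L) L)).injective
  have hρbij : Function.Bijective ρ := by
    constructor
    · intro γ γ' h
      have hm : ((((γ : ↥(quatAdelicUnitsOne L Ha)) : ↥(quatAdelicUnits L Ha)) : GL (Fin 2) (AdeleRing (𝓞 L) L)) : Matrix (Fin 2) (Fin 2) (AdeleRing (𝓞 L) L)) =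
          ((((γ' : ↥(quatAdelicUnitsOne L Ha)) : ↥(quatAdelicUnits L Ha)) : GL (Fin 2) (AdeleRing (𝓞 L) L)) : Matrix (Fin 2) (Fin 2) (AdeleRing (𝓞 L) L)) := by
        rw [hρ, hρ, h]
      exact Subtype.ext (Subtype.ext (Subtype.ext (Units.ext hm)))
    · intro ξ
      have hξ : (ξ : ↥(quatRatSubalgebra L Ha)) ≠ 0 := by
        have h := ξ.2; rwa [Finset.mem_singleton] at h
      obtain ⟨γ, hγ⟩ := exists_quatRatLatticeOne_coe_eq L hanis (ξ : ↥(quatRatSubalgebra L Ha)) hξ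
      refine ⟨γ, Subtype.ext (Subtype.ext (hinj_map ?_))⟩
      change (((ρ γ : ↥(quatRatSubalgebra L Ha)) : Matrix (Fin 2) (Fin 2) L)).map _ = ((ξ : ↥(quatRatSubalgebra L Ha)) : Matrix (Fin 2) (Fin 2) L).map _
      rw [← hρ, hγ]
  -- reindex and split off the zero term
  have hsplit := hf.sum_add_tsum_subtype_compl ({0} : Finset ↥(quatRatSubalgebra L Ha))
  rw [Finset.sum_singleton] at hsplit
  rw [← hsplit, ZeroMemClass.coe_zero, Matrix.map_zero _ (map_zero _), add_sub_cancel_left,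
    ← Equiv.tsum_eq (Equiv.ofBijective ρ hρbij)]
  exact tsum_congr fun γ => by rw [Equiv.ofBijective_apply, hρ]

/-- **The `γ ↦ γ⁻¹` reindexing of a `Γ_h`-sum**: `∑_{γ ∈ Γ_h} g(γ⁻¹) = ∑_{γ ∈ Γ_h} g(γ)` (Mathlib `Equiv.tsum_eq` along `Equiv.inv`). [folklore] -/
theorem tsum_quatRatLatticeOne_inv {E : Type*} [AddCommMonoid E] [TopologicalSpace E] (g : ↥(quatRatLatticeOne L Ha) → E) :
    ∑' γ : ↥(quatRatLatticeOne L Ha), g γ⁻¹ = ∑' γ : ↥(quatRatLatticeOne L Ha), g γ :=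
  (Equiv.inv ↥(quatRatLatticeOne L Ha)).tsum_eq g

end GammaSums

end Summit.HodgeConjecture.HodgeConjecture.Cruxes.H413.K2E5QuatZetaMinusPrincipalPart

end
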